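import Summits.BirchSwinnertonDyer.Rank1Residual.Partition.GreenbergVatsalIsogenyClassPeriod
import HarnessLib

/-!
# Crux `MazurMCOnCellB` (stmt-BirchSwinnertonDyer-19033), line `mudescent`, stub
# `stub_analyticMuZero_offLocus` — helper 1: the real period along a `p`-isogeny whose kernel is a
# rational line of TYPE A (unramified-even), I: the even-kernel archimedean count and the Vélu
# quotient (cell `bsd-eis`, seat `bsd-eis-mu-a`, PART 1b seat (1))

WHY (seat brief = ky g7's `Lines-mudescent.md`, ACCEL-LIST (1) + CORRECTION of 2026-08-26). The
registered stub `stub_analyticMuZero_offLocus : ∀ W₀ p, X2.CellB W₀ p → ¬ HasRamifiedOddLineAt W₀ p →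
X2.AnalyticMuLE W₀ p 0` asks for the vanishing of the ANALYTIC `μ`-invariant of the Mazur–Tate–
Teitelbaum `p`-adic `L`-function of the off-locus member `W₀` of a type-A (`¬ GVPar`) multiplicative
Eisenstein isogeny class, normalised by ITS Néron period. Inside one `ℚ`-isogeny class the
invariant `μ_an(W)` depends on the member only through `ord_p` of the real period `Ω(W)`; so the
stub is governed by how `Ω` moves along `p`-isogenies whose kernel is a type-A rational line —
UNRAMIFIED-EVEN or RAMIFIED-ODD, the complement of the Greenberg–Vatsal types treated by the tree's
PROVED period clause Cor. (3.8) (`GVPeriod.realPeriodRat_eq_unit_mul_of_isIsogenous_of_gvPar`, whose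
module docstring records the present case as «Remark, not used: along a `p`-isogeny whose kernel
is a line of the OTHER type the ratio is `p^{±1}`»). This file proves the unramified-even step:

* §1 `natCard_ker_inf_range_eq_of_lineEven` — **`#ker(ψ_ℂ|E(ℝ)) = p`** for an isogeny whose kernel
  is an EVEN rational `p`-line (every point of the kernel is fixed by the complex conjugation of
  `Γ_ℚ` attached to `ℚ̄ → ℂ`, hence real), the twin of the tree's
  `X2.IsogenyKernelRealPoints.natCard_ker_inf_range_eq_one_of_lineOdd`;
* §2 `exists_multiplier_of_lineEven` — hence **`p · Ω(E') = |k| · Ω(E)`** for the analytic multiplier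
  `k` (Milne's archimedean factor `#ker · Ω(E') = [E'(ℝ) : ψ_ℂE(ℝ)] · |k| · Ω(E)`, index `1` by the
  tree's `relIndex_map_range_eq_one`), with the `x`-formula `lc A = k⁻²` and `k ∈ ℤ` on globally
  minimal models (Dokchitser–Dokchitser 2015, Thm. 2 with `λ = p` for `ker φ ⊆ E(ℝ)`);
* (helper 2, `…TypeAPeriodQuotient`) the Vélu quotient by an UNRAMIFIED-EVEN rational `p`-line then
  has `p · Ω(E') = u · Ω(E)` with `|u|_p = 1` (the parity-free `p`-adic core of the tree).

Printed counterparts: G. Stevens, Invent. Math. 98 (1989) §2 (étale isogenies preserve the Néron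
lattice; the minimal curve `A_min`); T. & V. Dokchitser, Trans. AMS 367 (2015) Thm. 2, Props. 16/18
(`Ω(E)/Ω(E') = λ·|ω/φ^*ω'|`); Greenberg–Vatsal 2000 §3 Rem. after Cor. (3.8) (`X₀(11)` at `5`:
`Ω(11a3) = 5·Ω(11a1)`). HONEST FRAMING: kernel theorems only (no definition, no named fact); nothing
here proves the stub — it is the first half of the reduction «the off-locus member minimises `μ_an`
in its class» (helpers 2–3). References: [DokchitserLocalInvariants2015] Thm. 2, Props. 16, 18;
[Stevens1989] §2; [MilneADT2006] I §7; [SilvermanAEC2009] VI.4.1(b), III.4.12;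
[GreenbergVatsal2000] §3 p. 40.
-/

set_option autoImplicit false

noncomputable section

open scoped Classical ComplexConjugate NNReal NumberField

open WeierstrassCurve Polynomial Field Complex IsDedekindDomain NumberField
  Literature.NumberTheory.EllipticCurves Literature.NumberTheory.EllipticCurves.Rank1Residual
  Literature.NumberTheory.EllipticCurves.FormalGroupChart WeierstrassCurve.geomPoints
  Literature.NumberTheory.GaloisRepresentations _root_.PeriodPair Rat.HeightOneSpectrum
  Summit.BirchSwinnertonDyer.Rank1Residual

-- `Summit.BirchSwinnertonDyer.BirchSwinnertonDyer.…`: the summit and its single sub-problem share a name (D-0017 layout).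
set_option linter.dupNamespace false

namespace Summit.BirchSwinnertonDyer.BirchSwinnertonDyer.Theorems.EisensteinPrimesMazurMCOnCellBTypeAPeriodStep

/-! ## §1. An even kernel consists of real points: `#ker(ψ_ℂ|E(ℝ)) = p` -/

section Analytic

variable [Algebra (AlgebraicClosure ℚ) ℂ] [IsScalarTower ℚ (AlgebraicClosure ℚ) ℂ]
variable {W W' : WeierstrassCurve ℚ} [W.IsElliptic] [W'.IsElliptic] {p : ℕ} [hp : Fact p.Prime]

omit [Algebra (AlgebraicClosure ℚ) ℂ] [IsScalarTower ℚ (AlgebraicClosure ℚ) ℂ] [W.IsElliptic]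
  [W'.IsElliptic] hp in
/-- A point of `E(ℂ)` fixed by coordinatewise complex conjugation is a real point (in the image of
`(E ⊗ ℝ)(ℝ)`): its coordinates are real and satisfy the equation over `ℝ` (`baseChange_nonsingular`
along the injection `ℝ → ℂ`). The converse half is inside the tree's
`range_map_eq_map_realLocus_of_uniformization`. [folklore] -/
theorem mem_range_of_map_conj_eq (σc : ℂ →ₐ[ℚ] ℂ) (hσc : ∀ z, σc z = conj z)
    {R : (W.baseChange ℂ).toAffine.Point} (hR : Affine.Point.map (W' := W) σc R = R) :
    R ∈ (Affine.Point.map (W' := W) (IsScalarTower.toAlgHom ℚ ℝ ℂ)).range := by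
  have hιapp : ∀ s : ℝ, IsScalarTower.toAlgHom ℚ ℝ ℂ s = (s : ℂ) := fun s ↦ rfl
  rcases R with _ | ⟨x, y, hxy⟩
  · exact ⟨0, map_zero _⟩
  · rw [Affine.Point.map_some, Affine.Point.some.injEq, hσc, hσc] at hR
    obtain ⟨hx, hy⟩ := hR
    have hx' : ((x.re : ℝ) : ℂ) = x := Complex.conj_eq_iff_re.mp hx
    have hy' : ((y.re : ℝ) : ℂ) = y := Complex.conj_eq_iff_re.mp hy
    have hns : (W.baseChange ℝ).toAffine.Nonsingular x.re y.re := by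
      refine (W.toAffine.baseChange_nonsingular (B := ℂ)
        (IsScalarTower.toAlgHom ℚ ℝ ℂ).toRingHom.injective x.re y.re).mp ?_
      rw [hιapp, hιapp, hx', hy']
      exact hxy
    refine ⟨.some x.re y.re hns, ?_⟩
    rw [Affine.Point.map_some, Affine.Point.some.injEq, hιapp, hιapp]
    exact ⟨hx', hy'⟩

omit [W.IsElliptic] [W'.IsElliptic] in
/-- **`#ker(ψ_ℂ|E(ℝ)) = p` for an isogeny whose kernel is an EVEN rational `p`-line.** A point of
`ker ψ_ℂ` is `j_* P` with `P ∈ Φ₀` (`Isogeny.ker_baseChange_eq_map`); for the complex conjugation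
`c ∈ Γ_ℚ` attached to `j : ℚ̄ → ℂ` (`X2.IsogenyKernelRealPoints.exists_conj_restrict`) one has
`cP = P` (`Φ₀` even), so `j_* P` is fixed by conjugation (`geomPoints.map_map_toAlgHom`) and is a
real point: `ker ψ_ℂ ≤ E(ℝ)`, and `#ker ψ_ℂ = #ker ψ = p`. (Dokchitser–Dokchitser 2015, Thm. 2:
`λ = p` when `ker φ ⊆ E(ℝ)`.) [folklore] -/
theorem natCard_ker_inf_range_eq_of_lineEven (ψ : Isogeny W W')
    {Φ₀ : AddSubgroup (geomTorsion W (p : ℤ))} (hΦ : IsRationalLine W p Φ₀)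
    (hker : ψ.toAddMonoidHom.ker = Φ₀.map (geomTorsion W (p : ℤ)).subtype)
    (heven : LineEven W p Φ₀) :
    Nat.card ↥((ψ.baseChange (M := ℂ)).ker ⊓
      (Affine.Point.map (W' := W) (IsScalarTower.toAlgHom ℚ ℝ ℂ)).range) = p := by
  -- complex conjugation
  obtain ⟨σc, hσc⟩ := exists_algHom_conj (K := ℚ) conj_algebraMap
  obtain ⟨c, hf, hcc⟩ := X2.IsogenyKernelRealPoints.exists_conj_restrict σc hσc
  -- every point of `ker ψ_ℂ` is real
  have hle : (ψ.baseChange (M := ℂ)).ker ≤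
      (Affine.Point.map (W' := W) (IsScalarTower.toAlgHom ℚ ℝ ℂ)).range := by
    intro R hR
    rw [ψ.ker_baseChange_eq_map, AddSubgroup.mem_map] at hR
    obtain ⟨s, hs, rfl⟩ := hR
    have hs' : s ∈ Φ₀.map (geomTorsion W (p : ℤ)).subtype := by rw [← hker]; exact hs
    obtain ⟨P, hP, rfl⟩ := hs'
    refine mem_range_of_map_conj_eq σc hσc ?_
    rw [geomPoints.map_map_toAlgHom σc c hf]
    have hfix : c • P = P := heven c hcc P hP
    have hfix' : c • ((geomTorsion W (p : ℤ)).subtype P) = (geomTorsion W (p : ℤ)).subtype P := by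
      change ((c • P : geomTorsion W (p : ℤ)) : W.geomPoints) = (P : W.geomPoints)
      rw [hfix]
    rw [hfix']
  rw [inf_eq_left.mpr hle]
  -- `#ker ψ_ℂ = #ker ψ = p`
  have hcard : Nat.card ψ.toAddMonoidHom.ker = p := by
    rw [hker]; exact X2.IsogenyQuotientLine.natCard_map_subtype hΦ
  rw [ψ.ker_baseChange_eq_map, ← hcard]
  exact (Nat.card_congr (ψ.toAddMonoidHom.ker.equivMapOfInjective _
    (Affine.Point.map_injective _)).toEquiv).symm

/-! ## §2. `p · Ω(E') = |k| · Ω(E)` for an even kernel -/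

/-- **The multiplier of an isogeny with EVEN rational `p`-line kernel controls the real periods up to
the factor `p`.** For an isogeny `ψ : E → E'` over `ℚ` (both elliptic) whose kernel is a rational
`p`-line `Φ₀` (`p` odd) that is EVEN, there is `k ∈ ℚˣ` (the analytic multiplier) with
(i) `p · Ω(E') = |k| · Ω(E)` (Milne's archimedean factor with `#ker(ψ_ℂ|E(ℝ)) = p`, §1, and index
`1`, tree `relIndex_map_range_eq_one`);
(ii) `x(ψP) = A(x)/B(x)` off `ker ψ`, `B` monic, `deg A = deg B + 1`, `lc A = k⁻²`;
(iii) `k ∈ ℤ` if both models are globally minimal. Twin of the tree's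
`X2.IsogenyKernelRealPoints.exists_multiplier_of_lineOdd_aux`.
[cite: MilneADT2006, Ch. I §7, proof of Thm. 7.3, p. 98] [cite: DokchitserLocalInvariants2015, Thm. 2] -/
theorem exists_multiplier_of_lineEven_aux (hp2 : p ≠ 2) (ψ : Isogeny W W')
    {Φ₀ : AddSubgroup (geomTorsion W (p : ℤ))} (hΦ : IsRationalLine W p Φ₀)
    (hker : ψ.toAddMonoidHom.ker = Φ₀.map (geomTorsion W (p : ℤ)).subtype)
    (heven : LineEven W p Φ₀) :
    ∃ k : ℚ, k ≠ 0 ∧ (p : ℝ) * W'.realPeriodRat = |(k : ℝ)| * W.realPeriodRat ∧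
      (∃ A B : ℚ[X], B.Monic ∧ A.natDegree = B.natDegree + 1 ∧ A.leadingCoeff = k⁻¹ ^ 2 ∧
        ∀ (x y : AlgebraicClosure ℚ)
          (h : (W.baseChange (AlgebraicClosure ℚ)).toAffine.Nonsingular x y),
          ψ (Affine.Point.some x y h) ≠ 0 →
          aeval x B ≠ 0 ∧ ∃ (y₂ : AlgebraicClosure ℚ)
            (h₂ : (W'.baseChange (AlgebraicClosure ℚ)).toAffine.Nonsingular (aeval x A / aeval x B) y₂),
            ψ (Affine.Point.some x y h) = Affine.Point.some (aeval x A / aeval x B) y₂ h₂) ∧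
      (W.IsGloballyMinimal → W'.IsGloballyMinimal → ∃ n : ℤ, (n : ℚ) = k) := by
  have hpP : p.Prime := hp.out
  haveI hWℝ : (W.baseChange ℝ).IsElliptic := by rw [WeierstrassCurve.baseChange]; infer_instance
  haveI hWℝ' : (W'.baseChange ℝ).IsElliptic := by rw [WeierstrassCurve.baseChange]; infer_instance
  obtain ⟨k, hk0, hperiod, hall⟩ := ψ.exists_algebraMap_card_ker_inf_realPoints_mul_realPeriod_eq
  -- Néron-type period pairs and uniformisations
  have hc₄ : (((W.baseChange ℝ).c₄ : ℝ) : ℂ) = (W.baseChange ℂ).c₄ := by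
    rw [WeierstrassCurve.baseChange, WeierstrassCurve.baseChange, map_c₄, map_c₄,
      ofReal_algebraMap_eq]
  have hc₆ : (((W.baseChange ℝ).c₆ : ℝ) : ℂ) = (W.baseChange ℂ).c₆ := by
    rw [WeierstrassCurve.baseChange, WeierstrassCurve.baseChange, map_c₆, map_c₆,
      ofReal_algebraMap_eq]
  have hc₄' : (((W'.baseChange ℝ).c₄ : ℝ) : ℂ) = (W'.baseChange ℂ).c₄ := by
    rw [WeierstrassCurve.baseChange, WeierstrassCurve.baseChange, map_c₄, map_c₄,
      ofReal_algebraMap_eq]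
  have hc₆' : (((W'.baseChange ℝ).c₆ : ℝ) : ℂ) = (W'.baseChange ℂ).c₆ := by
    rw [WeierstrassCurve.baseChange, WeierstrassCurve.baseChange, map_c₆, map_c₆,
      ofReal_algebraMap_eq]
  obtain ⟨L, hL₂, hL₃, -⟩ := (W.baseChange ℝ).exists_periodPair_realPeriod_eq_holds
  obtain ⟨L', hL₂', hL₃', -⟩ := (W'.baseChange ℝ).exists_periodPair_realPeriod_eq_holds
  have h₂ : L.g₂ = (W.baseChange ℂ).c₄ / 12 := by rw [hL₂, ← hc₄]; push_cast; ring
  have h₃ : L.g₃ = (W.baseChange ℂ).c₆ / 216 := by rw [hL₃, ← hc₆]; push_cast; ring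
  have h₂' : L'.g₂ = (W'.baseChange ℂ).c₄ / 12 := by rw [hL₂', ← hc₄']; push_cast; ring
  have h₃' : L'.g₃ = (W'.baseChange ℂ).c₆ / 216 := by rw [hL₃', ← hc₆']; push_cast; ring
  obtain ⟨u, hkeru, hsurj, hu⟩ := L.exists_addMonoidHom_of_g₂_g₃' h₂ h₃
  obtain ⟨u', hkeru', hsurj', hu'⟩ := L'.exists_addMonoidHom_of_g₂_g₃' h₂' h₃'
  obtain ⟨hle, happ, -⟩ := hall h₂ h₃ h₂' h₃' u hkeru hu u' hkeru' hu'
  -- `#ker ψ = p`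
  have hcard : Nat.card ψ.toAddMonoidHom.ker = p := by
    rw [hker]; exact X2.IsogenyQuotientLine.natCard_map_subtype hΦ
  -- the two archimedean counts
  have hN := natCard_ker_inf_range_eq_of_lineEven ψ hΦ hker heven
  have hI := X2.IsogenyKernelRealPoints.relIndex_map_range_eq_one hp2 ψ h₂ h₃ h₂' h₃' hkeru hsurj
    hu hkeru' hsurj' hu' hk0 happ hcard
  rw [hN, hI, Nat.cast_one, one_mul, eq_ratCast] at hperiod
  refine ⟨k, hk0, hperiod, ?_, fun hmin hmin' ↦ ?_⟩
  · exact ψ.exists_x_formula_of_baseChange_apply_eq h₂ h₃ h₂' h₃' hsurj hu hkeru' hu' hk0 hle happ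
  · haveI := hmin
    haveI := hmin'
    have hle' : ∀ z ∈ L.lattice, (k : ℂ) * z ∈ L'.lattice := fun z hz ↦ by
      rw [← eq_ratCast (algebraMap ℚ ℂ)]; exact hle z hz
    exact integral_neronScaling_of_isGloballyMinimal_holds W W' L L' ⟨h₂, h₃⟩ ⟨h₂', h₃'⟩ k hle'

end Analytic

/-- **`p · Ω(E') = |k| · Ω(E)` along an isogeny with even rational `p`-line kernel**, with the
`x`-coordinate formula of multiplier `k` and its integrality for globally minimal models — the
statement of `exists_multiplier_of_lineEven_aux` freed from the auxiliary embedding `ℚ̄ → ℂ`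
(any `IsAlgClosed.lift`). (Dokchitser–Dokchitser 2015, Thm. 2 at `𝒦 = ℝ`, `p ≠ 2`,
`ker φ ⊆ E(ℝ)`: `Ω(E,ω)/Ω(E',ω') = p·|ω/φ^*ω'|`; Milne *ADT* I.7.)
[cite: MilneADT2006, Ch. I §7, proof of Thm. 7.3, p. 98] [cite: DokchitserLocalInvariants2015, Thm. 2] -/
theorem exists_multiplier_of_lineEven {W W' : WeierstrassCurve ℚ} [W.IsElliptic] [W'.IsElliptic]
    {p : ℕ} [Fact p.Prime] (hp2 : p ≠ 2) (ψ : Isogeny W W')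
    {Φ₀ : AddSubgroup (geomTorsion W (p : ℤ))} (hΦ : IsRationalLine W p Φ₀)
    (hker : ψ.toAddMonoidHom.ker = Φ₀.map (geomTorsion W (p : ℤ)).subtype)
    (heven : LineEven W p Φ₀) :
    ∃ k : ℚ, k ≠ 0 ∧ (p : ℝ) * W'.realPeriodRat = |(k : ℝ)| * W.realPeriodRat ∧
      (∃ A B : ℚ[X], B.Monic ∧ A.natDegree = B.natDegree + 1 ∧ A.leadingCoeff = k⁻¹ ^ 2 ∧
        ∀ (x y : AlgebraicClosure ℚ)
          (h : (W.baseChange (AlgebraicClosure ℚ)).toAffine.Nonsingular x y),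
          ψ (Affine.Point.some x y h) ≠ 0 →
          aeval x B ≠ 0 ∧ ∃ (y₂ : AlgebraicClosure ℚ)
            (h₂ : (W'.baseChange (AlgebraicClosure ℚ)).toAffine.Nonsingular (aeval x A / aeval x B) y₂),
            ψ (Affine.Point.some x y h) = Affine.Point.some (aeval x A / aeval x B) y₂ h₂) ∧
      (W.IsGloballyMinimal → W'.IsGloballyMinimal → ∃ n : ℤ, (n : ℚ) = k) := by
  haveI hQbar : Algebra.IsAlgebraic ℚ (AlgebraicClosure ℚ) := AlgebraicClosure.isAlgebraic ℚ
  letI : Algebra (AlgebraicClosure ℚ) ℂ :=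
    (IsAlgClosed.lift : AlgebraicClosure ℚ →ₐ[ℚ] ℂ).toRingHom.toAlgebra
  haveI : IsScalarTower ℚ (AlgebraicClosure ℚ) ℂ :=
    IsScalarTower.of_algebraMap_eq' (Subsingleton.elim _ _)
  exact exists_multiplier_of_lineEven_aux hp2 ψ hΦ hker heven

end Summit.BirchSwinnertonDyer.BirchSwinnertonDyer.Theorems.EisensteinPrimesMazurMCOnCellBTypeAPeriodStep

end
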